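/-
Origin: expansion seat `prover-pub-hodgecm-mc-binder-1-g15-0`, handover #R95 2026-08-20T18:37:14Z md5 3c2d2bd3d93f (357 l.; NEW additive universe-free datum-generic leaf; imports Model/HeckeOperatorOf (#R89, PKG) + Vendored HodgeTheory/BettiUniverseAxioms only; drops ⇒ {#R96, #R97}; NAME LIST: HodgeCM.Model.LevelCoverAlgebraic.levelHomeo_toLevel_toBall · HodgeCM.Model.LevelCoverAlgebraic.mapContinuous_comp_levelHomeo · HodgeCM.Model.LevelCoverAlgebraic.mapContinuous_comp_levelHomeo_act · HodgeCM.Model.LevelCoverAlgebraic.map_heckeCorrespondenceAction_eq_sum · HodgeCM.Model.LevelCoverAlgebraic.pull_heckeOpC_eq_sum) (`HOME/mc/pub-hodgecm-mc-binder-1-g15/stage59/HodgeCM/Model/LevelCoverAlgebraic.lean`, md5 3c2d2bd3d93f, 357 lines);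
landed by the gen-24 packager (p-g24) in gate run 59 as `HodgeCM/Model/LevelCoverAlgebraic.lean` (verbatim).
-/
/-
Copyright (c) 2026 the pub-hodgecm formalisation cell (harness21).  New file, not vendored.
Origin: session prover-pub-hodgecm-mc-binder-1-g15-0 (unit pub-hodgecm-mc-binder-1-g15, BINDER PROVER gen 15 of lineage mc-binder-1;
content lane (J-Liu-Θ), scope memo `HOME/mc/pub-hodgecm-mc-binder-1-g14/JLIU-THETA-SCOPE.md` §9 (J2), HECKE-TOWER sub-leaf (T3):
«the algebraic level cover `X_N` IS the topological level cover `N\𝔹` of the vendored Hecke file, and the defining identity of `T_g` transported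
to the algebraic models»), 2026-08-20.  Intended final place: `HodgeCM/Model/LevelCoverAlgebraic.lean` (NEW additive leaf, universe-free,
datum-generic; imports ONLY `HodgeCM.Model.HeckeOperatorOf` (#R89) and the vendored twin `…HodgeTheory.BettiUniverseAxioms`; nothing imports it;
drop alone on bounce).
-/
import Summits.HodgeConjecture.HodgeCM.Model.HeckeOperatorOf
import Literature.AlgebraicGeometry.HodgeTheory.BettiUniverseAxioms

set_option autoImplicit false

/-!
# The algebraic level cover `X_N(ℂ) ≃ₜ N\𝔹` and the Hecke identity `π^*(T_g x) = [Γ':N_g]⁻¹ Σ_q π_{g γ_q}^* x` on the algebraic models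

Let `D : UnitaryBallQuotientDatum p X` (`X(ℂ) ≅ Γ\𝔹`), `N ≤ Γ` a subgroup, and let `DN : UnitaryBallUniformisationDatum p XN` be a ball
uniformization of ANOTHER smooth projective variety `XN` by THE SAME hermitian space with group `N`: `DN.Hℂ = D.Hℂ` and `Γ_N^{τ₁} = N^{τ₁}` in
`GL_{p+1}(ℂ)` — the situation of the model universe, where every level `N : Level V` has its own surface `U.pms L ι₁ V N` realised by the cited
record (ii-a) `BallQuotientUniformised`.  The vendored Hecke file (`ShimuraVarieties/HeckeCorrespondenceAction`, [Shimura 1971 §3.1, §7.2–7.3, §8.3])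
presents the level cover TOPOLOGICALLY as the orbit space `D.LevelCover N = N\𝔹` with its projection `D.levelProj N` and translated projections
`D.coverMap g` (`N[v] ↦ Γ[g v]`), and DEFINES `T_g` on `Hᵏ(X(ℂ); ℂ)` through the transfer of the Galois cover `N_g\𝔹 → X(ℂ)`, pinned by
`levelProj_map_heckeCorrespondenceAction : π^*(T_g x) = [Γ ∩ g⁻¹Γg : N_g]⁻¹ Σ_{q ∈ Γ/N_g} (π_g ∘ q)^* x`.  This file identifies the two presentations:

* `levelHomeo D N DN hH hΓ : D.LevelCover N ≃ₜ XN(ℂ)`, `N[v] ↦ unif_N v` (`levelHomeo_toLevel_toBall`) — both sides are `N\𝔹`: well defined and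
  injective by the two fibre clauses `unif_eq_unif_iff`, continuous/open/onto by the clauses of `DN.unif`;
* `mapContinuous_comp_levelHomeo` — an algebraic `π : XN ⟶ X` over the uniformizations (`π(ℂ)(unif_N v) = unif v`; glue-1's `Model.coverOf` /
  `LevelCovering.exists_hom_map_unif_eq`) IS `levelProj N` through `levelHomeo`; `mapContinuous_comp_levelHomeo_act` — an algebraic `π_g : XN ⟶ X` over the
  translate (`π_g(ℂ)(unif_N v) = unif (g v)`; `LevelCoveringTwist.exists_hom_map_unif_eq_mulVec`) IS `coverMap g`;
* `map_heckeCorrespondenceAction_eq_sum` — **the defining identity on the algebraic models**: for `g` admissible, `DN` modelling the Hecke level `N_g`,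
  `π` over the uniformizations and `π_q` over the translates by `g γ̃_q` (`γ̃_q = out q`, `q ∈ Γ/N_g`):
  `π(ℂ)^* (T_g x) = [Γ ∩ g⁻¹Γg : N_g]⁻¹ • Σ_q π_q(ℂ)^* x` in `Hᵏ(XN(ℂ); ℂ)` (transport along `levelHomeo`, functoriality of `Hᵏ`, `Hᵏ(levelHomeo)` an
  isomorphism);
* `pull_heckeOpC_eq_sum` — the same in the model universe's currency `ℂ ⊗ Hᵏ(·; ℚ)` with #R89's `heckeOpC` and `BettiUniverse.pull`:
  `(pull π k)_ℂ (heckeOpC D hX k g t) = [Γ ∩ g⁻¹Γg : N_g]⁻¹ • Σ_q (pull π_q k)_ℂ t` (naturality of the complexification `β`, vendored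
  `map_ofRatClassBaseChange`, and injectivity of `β`).

With `ClassLiftTwist.classLift_pull_mulVec` (lift of `π_q^* ω` = `(g γ̃_q)^*` lift ω) and glue-1's `classLift_pull` this leaves, for the (J2) identity
«`lift (T_g ω) = hecke (lift ω)`» on `F¹H¹`, exactly the Hodge-type statement `T_g F¹ ⊆ F¹` (next leaf).  KIND: kernel constructions + theorems over the
vendored tree modules; nothing cited anew, nothing minted; 0 proof holes; expected `#print axioms` ⊆ {propext, Classical.choice, Quot.sound}.

References: G. Shimura, *Introduction to the arithmetic theory of automorphic functions* (1971), §7.2–7.3, §8.3; N. Bergeron, J. Millson, C. Moeglin,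
Acta Math. 216 (2016), Introduction §1.1 (the tower of congruence ball quotients), Part 2 §1.8; A. Hatcher, *Algebraic Topology* (2002), §3.1, §3.G;
C. Voisin, *Hodge Theory and Complex Algebraic Geometry I* (2002), §7.1.1 (`Hᵏ(X;ℚ) ⊗ ℂ = Hᵏ(X;ℂ)`).
-/

noncomputable section

open Matrix MulAction Function Set
open scoped TensorProduct
open CategoryTheory
open Literature.AlgebraicGeometry.HodgeTheory
open Literature.AlgebraicGeometry.Motives (SchemeOver ComplexPoints AlgPoints bettiCohomology ofRatClassBaseChange IsSmoothProjective)
open Literature.AlgebraicTopology.SingularHomology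
open Literature.Topology.CoveringSpaces

namespace HodgeCM.Model.LevelCoverAlgebraic

open Literature.AlgebraicGeometry.ShimuraVarieties UnitaryBallQuotientDatum

variable {p : ℕ} {X XN : SchemeOver ℂ} (D : UnitaryBallQuotientDatum p X) (N : Subgroup ↥D.Γ)
  (DN : UnitaryBallUniformisationDatum p XN)
  (hH : DN.Hℂ = D.Hℂ)
  (hΓ : DN.Γ.map (Matrix.GeneralLinearGroup.map DN.τ₁) = (N.map D.Γ.subtype).map (Matrix.GeneralLinearGroup.map D.τ₁))

/-! ### `unif_N` on the cone of `D`: constant on `N·ℂˣ`-orbits -/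

section UnifN

include hH

/-- A cone vector of `D` is a cone vector of `DN` (same hermitian space). [folklore] -/
theorem mem_cone (v : D.cone) : (v : Fin (p + 1) → ℂ) ∈ DN.cone := by
  have h := v.2
  change (v : Fin (p + 1) → ℂ) ∈ negCone D.Hℂ at h
  change (v : Fin (p + 1) → ℂ) ∈ negCone DN.Hℂ
  rwa [hH]

/-- `unif_N` is constant on punctured lines of the cone. [folklore] -/
theorem unif_units_smul (c : ℂˣ) (v : D.cone) : DN.unif ((c • v : D.cone) : Fin (p + 1) → ℂ) = DN.unif v := by
  rw [coe_units_smul]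
  exact DN.unif_smul c.ne_zero (mem_cone D DN hH v)

include hΓ

omit hH in
/-- An element of `N`, read in `GL_{p+1}(ℂ)`, is an element of `Γ_N` read in `GL_{p+1}(ℂ)`. [folklore] -/
theorem exists_mem_ΓN (n : ↥N) :
    ∃ γ ∈ DN.Γ, ((γ : GL (Fin (p + 1)) DN.E) : Matrix (Fin (p + 1)) (Fin (p + 1)) DN.E).map DN.τ₁ =
      ((((n : ↥D.Γ) : GL (Fin (p + 1)) D.E)) : Matrix (Fin (p + 1)) (Fin (p + 1)) D.E).map D.τ₁ := by
  have hmem : Matrix.GeneralLinearGroup.map D.τ₁ ((n : ↥D.Γ) : GL (Fin (p + 1)) D.E) ∈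
      (N.map D.Γ.subtype).map (Matrix.GeneralLinearGroup.map D.τ₁) :=
    Subgroup.mem_map_of_mem _ (Subgroup.mem_map_of_mem _ n.2)
  rw [← hΓ] at hmem
  obtain ⟨γ, hγ, hγeq⟩ := Subgroup.mem_map.1 hmem
  exact ⟨γ, hγ, congrArg (fun u : GL (Fin (p + 1)) ℂ ↦ (u : Matrix (Fin (p + 1)) (Fin (p + 1)) ℂ)) hγeq⟩

omit hH in
/-- Conversely an element of `Γ_N`, read in `GL_{p+1}(ℂ)`, comes from `N`. [folklore] -/
theorem exists_mem_N {γ : GL (Fin (p + 1)) DN.E} (hγ : γ ∈ DN.Γ) :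
    ∃ n : ↥N, ((γ : GL (Fin (p + 1)) DN.E) : Matrix (Fin (p + 1)) (Fin (p + 1)) DN.E).map DN.τ₁ =
      ((((n : ↥D.Γ) : GL (Fin (p + 1)) D.E)) : Matrix (Fin (p + 1)) (Fin (p + 1)) D.E).map D.τ₁ := by
  have hmem : Matrix.GeneralLinearGroup.map DN.τ₁ γ ∈ DN.Γ.map (Matrix.GeneralLinearGroup.map DN.τ₁) :=
    Subgroup.mem_map_of_mem _ hγ
  rw [hΓ] at hmem
  obtain ⟨δ, hδ, hδeq⟩ := Subgroup.mem_map.1 hmem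
  obtain ⟨n, hn, rfl⟩ := Subgroup.mem_map.1 hδ
  exact ⟨⟨n, hn⟩, (congrArg (fun u : GL (Fin (p + 1)) ℂ ↦ (u : Matrix (Fin (p + 1)) (Fin (p + 1)) ℂ)) hδeq).symm⟩

/-- `unif_N` is `N`-invariant on the cone of `D`: `unif_N (n v) = unif_N v`. [cite: Shimura1973, §7.2] -/
theorem unif_subgroup_smul (n : ↥N) (v : D.cone) :
    DN.unif ((((n : ↥D.Γ) • v) : D.cone) : Fin (p + 1) → ℂ) = DN.unif v := by
  obtain ⟨γ, hγ, hγeq⟩ := exists_mem_ΓN D N DN hΓ n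
  have hv := mem_cone D DN hH v
  have hnv := mem_cone D DN hH ((n : ↥D.Γ) • v)
  rw [coe_subgroup_smul] at hnv ⊢
  symm
  refine (DN.unif_eq_unif_iff _ hv _ hnv).2 ⟨γ, hγ, 1, one_ne_zero, ?_⟩
  rw [hγeq, one_smul]

end UnifN

/-! ### The homeomorphism `N\𝔹 ≃ₜ XN(ℂ)` -/

section Homeo

include hH hΓ

/-- **The comparison map `N\𝔹 → XN(ℂ)`**, `N[v] ↦ unif_N v`. [cite: Shimura1973, §7.2] [cite: BergeronMillsonMoeglin2016Balls, Introduction §1.1] -/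
def levelPts : D.LevelCover N → ComplexPoints XN :=
  Quotient.lift
    (Quotient.lift (fun v : D.cone ↦ DN.unif v) fun v w h ↦ by
      obtain ⟨c, rfl⟩ := MulAction.orbitRel_apply.1 h
      exact unif_units_smul D DN hH c w)
    fun b b' h ↦ by
      obtain ⟨n, rfl⟩ := MulAction.orbitRel_apply.1 h
      induction b' using Quotient.inductionOn with
      | h w => exact unif_subgroup_smul D N DN hH hΓ n w

/-- `levelPts (N[v]) = unif_N v`. [folklore] -/
@[simp]
theorem levelPts_toLevel_toBall (v : D.cone) : levelPts D N DN hH hΓ (D.toLevel N (D.toBall v)) = DN.unif v := rfl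

/-- The comparison map is continuous. [folklore] -/
theorem continuous_levelPts : Continuous (levelPts D N DN hH hΓ) :=
  continuous_quot_lift _ (continuous_quot_lift _
    (DN.continuousOn_unif.comp_continuous continuous_subtype_val fun v ↦ mem_cone D DN hH v))

/-- The comparison map is onto. [folklore] -/
theorem surjective_levelPts : Surjective (levelPts D N DN hH hΓ) := fun P ↦ by
  obtain ⟨v, hv, rfl⟩ := DN.surjOn_unif (mem_univ P)
  have hv' : v ∈ D.cone := by
    change v ∈ negCone D.Hℂ
    rw [← hH]
    exact hv
  exact ⟨D.toLevel N (D.toBall ⟨v, hv'⟩), rfl⟩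

/-- The comparison map is injective (the fibres of `unif_N` are the `Γ_N·ℂˣ = N·ℂˣ`-orbits). [cite: Shimura1973, §7.2] -/
theorem injective_levelPts : Injective (levelPts D N DN hH hΓ) := by
  intro e e' h
  induction e using Quotient.inductionOn with
  | h b =>
  induction e' using Quotient.inductionOn with
  | h b' =>
  induction b using Quotient.inductionOn with
  | h v =>
  induction b' using Quotient.inductionOn with
  | h w =>
    change DN.unif v = DN.unif w at h
    obtain ⟨γ, hγ, c, hc, hγv⟩ := (DN.unif_eq_unif_iff _ (mem_cone D DN hH v) _ (mem_cone D DN hH w)).1 h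
    obtain ⟨n, hn⟩ := exists_mem_N D N DN hΓ hγ
    -- `n • [v] = [w]` on the ball, hence `N[v] = N[w]`
    have hball : (n : ↥D.Γ) • D.toBall v = D.toBall w := by
      rw [smul_toBall, toBall_eq_toBall_iff]
      refine ⟨Units.mk0 c hc, Subtype.ext ?_⟩
      rw [coe_units_smul, coe_subgroup_smul]
      change (c • (w : Fin (p + 1) → ℂ)) = (((n : ↥D.Γ) : GL (Fin (p + 1)) D.E) : Matrix _ _ D.E).map D.τ₁ *ᵥ (v : Fin (p + 1) → ℂ)
      rw [← hn, hγv]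
    change Quotient.mk (orbitRel ↥N D.ball) (D.toBall v) = Quotient.mk (orbitRel ↥N D.ball) (D.toBall w)
    refine Quotient.sound (MulAction.orbitRel_apply.2 (MulAction.mem_orbit_iff.2 ⟨n⁻¹, ?_⟩))
    rw [← hball]
    change n⁻¹ • (n • D.toBall v) = D.toBall v
    rw [← mul_smul, inv_mul_cancel, one_smul]

/-- The comparison map is open (`unif_N` is open on the cone). [folklore] -/
theorem isOpenMap_levelPts : IsOpenMap (levelPts D N DN hH hΓ) := fun O hO ↦ by
  -- the cone of `D` as the cone of `DN`
  let ι : D.cone → DN.cone := fun v ↦ ⟨v, mem_cone D DN hH v⟩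
  have hι : Continuous ι := continuous_subtype_val.subtype_mk _
  have hιo : IsOpenMap ι := by
    intro U hU
    have : ι '' U = Subtype.val ⁻¹' (Subtype.val '' U) := by
      ext ⟨x, hx⟩
      constructor
      · rintro ⟨v, hv, hvx⟩
        exact ⟨v, hv, congrArg Subtype.val hvx⟩
      · rintro ⟨v, hv, hvx⟩
        refine ⟨v, hv, Subtype.ext hvx⟩
    rw [this]
    exact ((isOpen_negCone _).isOpenMap_subtype_val U hU).preimage continuous_subtype_val
  have himg : levelPts D N DN hH hΓ '' O = DN.cone.restrict DN.unif '' (ι '' ((fun v : D.cone ↦ D.toLevel N (D.toBall v)) ⁻¹' O)) := by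
    ext P
    constructor
    · rintro ⟨e, he, rfl⟩
      induction e using Quotient.inductionOn with
      | h b =>
      induction b using Quotient.inductionOn with
      | h v => exact ⟨ι v, ⟨v, he, rfl⟩, rfl⟩
    · rintro ⟨_, ⟨v, hv, rfl⟩, rfl⟩
      exact ⟨D.toLevel N (D.toBall v), hv, rfl⟩
  rw [himg]
  refine DN.isOpenMap_unif _ (hιo _ (hO.preimage ?_))
  exact continuous_quotient_mk'.comp continuous_quotient_mk'

/-- **The algebraic level cover is the topological one: `N\𝔹 ≃ₜ XN(ℂ)`**, `N[v] ↦ unif_N v`.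
[cite: Shimura1973, §7.2] [cite: BergeronMillsonMoeglin2016Balls, Introduction §1.1] -/
def levelHomeo : D.LevelCover N ≃ₜ ComplexPoints XN :=
  (Equiv.ofBijective _ ⟨injective_levelPts D N DN hH hΓ, surjective_levelPts D N DN hH hΓ⟩).toHomeomorphOfContinuousOpen
    (continuous_levelPts D N DN hH hΓ) (isOpenMap_levelPts D N DN hH hΓ)

/-- `levelHomeo (N[v]) = unif_N v`. [folklore] -/
@[simp]
theorem levelHomeo_toLevel_toBall (v : D.cone) : levelHomeo D N DN hH hΓ (D.toLevel N (D.toBall v)) = DN.unif v := rfl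

/-- **An algebraic map over the uniformizations is the level projection**: if `π : XN ⟶ X` satisfies `π(ℂ)(unif_N v) = unif v` on the cone
(glue-1's `coverOf`), then `π(ℂ) ∘ levelHomeo = levelProj N`. [cite: Shimura1973, §7.2] -/
theorem mapContinuous_comp_levelHomeo (π : XN ⟶ X) (hπ : ∀ v ∈ DN.cone, AlgPoints.map π (DN.unif v) = D.unif v) :
    (AlgPoints.mapContinuous (L := ℂ) π).comp (levelHomeo D N DN hH hΓ : C(D.LevelCover N, ComplexPoints XN)) = D.levelProj N := by
  refine ContinuousMap.ext fun e ↦ ?_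
  induction e using Quotient.inductionOn with
  | h b =>
  induction b using Quotient.inductionOn with
  | h v =>
    change AlgPoints.mapContinuous (L := ℂ) π (levelHomeo D N DN hH hΓ (D.toLevel N (D.toBall v))) = D.unif v
    rw [levelHomeo_toLevel_toBall, AlgPoints.mapContinuous_apply]
    exact hπ _ (mem_cone D DN hH v)

/-- **An algebraic map over a translate is the translated projection**: if `π_g : XN ⟶ X` satisfies `π_g(ℂ)(unif_N v) = unif (g v)` on the cone
(`LevelCoveringTwist`), then `π_g(ℂ) ∘ levelHomeo = coverMap g`. [cite: Shimura1973, §7.3] -/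
theorem mapContinuous_comp_levelHomeo_act (πg : XN ⟶ X) (g : GL (Fin (p + 1)) D.E) (hg : g ∈ unitaryGroup (conjRingHom D.E) D.H)
    (hN : ∀ γ ∈ N, g * (γ : GL (Fin (p + 1)) D.E) * g⁻¹ ∈ D.Γ)
    (hπ : ∀ v ∈ DN.cone, v ∈ D.cone → AlgPoints.map πg (DN.unif v) = D.unif (D.act g v)) :
    (AlgPoints.mapContinuous (L := ℂ) πg).comp (levelHomeo D N DN hH hΓ : C(D.LevelCover N, ComplexPoints XN)) = D.coverMap g hg hN := by
  refine ContinuousMap.ext fun e ↦ ?_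
  induction e using Quotient.inductionOn with
  | h b =>
  induction b using Quotient.inductionOn with
  | h v =>
    change AlgPoints.mapContinuous (L := ℂ) πg (levelHomeo D N DN hH hΓ (D.toLevel N (D.toBall v))) = D.unif (D.act g v)
    rw [levelHomeo_toLevel_toBall, AlgPoints.mapContinuous_apply]
    exact hπ _ (mem_cone D DN hH v) v.2

/-- `Hᵏ(levelHomeo)` is injective (a homeomorphism induces an isomorphism). [cite: HatcherAT2002, §3.1] -/
theorem map_levelHomeo_injective (k : ℕ) :
    Injective (singularCohomology.map ℂ ℂ (levelHomeo D N DN hH hΓ : C(D.LevelCover N, ComplexPoints XN)) k) :=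
  fun _ _ hxy ↦ (singularCohomology.mapIso ℂ ℂ (levelHomeo D N DN hH hΓ) k).toLinearEquiv.injective hxy

end Homeo

/-! ### The defining identity of `T_g` transported to the algebraic models -/

section Hecke

variable {D}
variable {g : GL (Fin (p + 1)) D.E} (h : D.IsHeckeAdmissible g)
variable {XN' : SchemeOver ℂ} (DN' : UnitaryBallUniformisationDatum p XN')
  (hH' : DN'.Hℂ = D.Hℂ)
  (hΓ' : DN'.Γ.map (Matrix.GeneralLinearGroup.map DN'.τ₁) =
    ((D.heckeLevel g).map D.Γ.subtype).map (Matrix.GeneralLinearGroup.map D.τ₁))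

include hH' hΓ'

/-- The summands: an algebraic map over the translate by `g γ̃_q` is `π_g ∘ q` through `levelHomeo` (`twist_comp_smul`). [cite: Shimura1973, §3.1] -/
theorem mapContinuous_comp_levelHomeo_eq_twist_comp (q : ↥D.Γ ⧸ D.heckeLevel g) (πq : XN' ⟶ X)
    (hπq : ∀ v ∈ DN'.cone, v ∈ D.cone →
      AlgPoints.map πq (DN'.unif v) = D.unif (D.act (g * ((Quotient.out q : ↥D.Γ) : GL (Fin (p + 1)) D.E)) v)) :
    (AlgPoints.mapContinuous (L := ℂ) πq).comp
        (levelHomeo D (D.heckeLevel g) DN' hH' hΓ' : C(D.LevelCover (D.heckeLevel g), ComplexPoints XN')) =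
      h.twist.comp ⟨fun e : D.LevelCover (D.heckeLevel g) ↦ q • e, continuous_const_smul q⟩ := by
  have hq : q = QuotientGroup.mk (Quotient.out q) := (QuotientGroup.out_eq' q).symm
  refine ContinuousMap.ext fun e ↦ ?_
  induction e using Quotient.inductionOn with
  | h b =>
  induction b using Quotient.inductionOn with
  | h v =>
    change AlgPoints.mapContinuous (L := ℂ) πq (levelHomeo D _ DN' hH' hΓ' (D.toLevel _ (D.toBall v))) =
      (IsHeckeAdmissible.twist D h) (q • Quotient.mk (orbitRel ↥(D.heckeLevel g) D.ball) (D.toBall v))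
    rw [levelHomeo_toLevel_toBall, AlgPoints.mapContinuous_apply, hπq _ (mem_cone D DN' hH' v) v.2]
    conv_rhs => rw [hq, OrbitQuotient.mk_smul_mk]
    change D.unif (D.act (g * _) v) = D.unif (D.act g (D.act _ v))
    rw [D.act_mul]

/-- **The defining identity of `T_g` on the algebraic models.** For `g` admissible, `DN'` a ball uniformization of `XN'` modelling the Hecke level
`N_g` (`Γ_{N'}^{τ₁} = N_g^{τ₁}`, same hermitian space), `π : XN' ⟶ X` over the uniformizations and `π_q : XN' ⟶ X` over the translates by
`g γ̃_q` (`γ̃_q = out q`):  `π(ℂ)^*(T_g x) = [Γ ∩ g⁻¹Γg : N_g]⁻¹ • Σ_{q ∈ Γ/N_g} π_q(ℂ)^* x` in `Hᵏ(XN'(ℂ); ℂ)`.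
[cite: Shimura1973, §3.4 and §8.3] [cite: BergeronMillsonMoeglin2016Balls, Part 2 §1.8] -/
theorem map_heckeCorrespondenceAction_eq_sum (π : XN' ⟶ X) (hπ : ∀ v ∈ DN'.cone, AlgPoints.map π (DN'.unif v) = D.unif v)
    (πq : ↥D.Γ ⧸ D.heckeLevel g → (XN' ⟶ X))
    (hπq : ∀ q, ∀ v ∈ DN'.cone, v ∈ D.cone →
      AlgPoints.map (πq q) (DN'.unif v) = D.unif (D.act (g * ((Quotient.out q : ↥D.Γ) : GL (Fin (p + 1)) D.E)) v))
    (k : ℕ) (x : complexBetti X k) :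
    letI : (D.heckeLevel g).FiniteIndex := h.finiteIndex
    letI : Fintype (↥D.Γ ⧸ D.heckeLevel g) := Subgroup.fintypeQuotientOfFiniteIndex
    singularCohomology.map ℂ ℂ (AlgPoints.mapContinuous (L := ℂ) π) k (D.heckeCorrespondenceAction k g x) =
      ((D.heckeIndex g : ℂ)⁻¹) • ∑ q : ↥D.Γ ⧸ D.heckeLevel g, singularCohomology.map ℂ ℂ (AlgPoints.mapContinuous (L := ℂ) (πq q)) k x := by
  haveI : (D.heckeLevel g).FiniteIndex := h.finiteIndex
  letI : Fintype (↥D.Γ ⧸ D.heckeLevel g) := Subgroup.fintypeQuotientOfFiniteIndex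
  set e : C(D.LevelCover (D.heckeLevel g), ComplexPoints XN') :=
    (levelHomeo D (D.heckeLevel g) DN' hH' hΓ' : C(D.LevelCover (D.heckeLevel g), ComplexPoints XN')) with he
  apply map_levelHomeo_injective D (D.heckeLevel g) DN' hH' hΓ' k
  -- left side: `e^* π^* (T_g x) = levelProj^* (T_g x)`
  have hL : singularCohomology.map ℂ ℂ e k (singularCohomology.map ℂ ℂ (AlgPoints.mapContinuous (L := ℂ) π) k (D.heckeCorrespondenceAction k g x)) =
      singularCohomology.map ℂ ℂ (D.levelProj (D.heckeLevel g)) k (D.heckeCorrespondenceAction k g x) := by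
    rw [← mapContinuous_comp_levelHomeo D (D.heckeLevel g) DN' hH' hΓ' π hπ, singularCohomology.map_comp]
    rfl
  -- right side, summand by summand: `e^* π_q^* x = (π_g ∘ q)^* x`
  have hR : ∀ q : ↥D.Γ ⧸ D.heckeLevel g,
      singularCohomology.map ℂ ℂ e k (singularCohomology.map ℂ ℂ (AlgPoints.mapContinuous (L := ℂ) (πq q)) k x) =
        singularCohomology.map ℂ ℂ (h.twist.comp ⟨fun e : D.LevelCover (D.heckeLevel g) ↦ q • e, continuous_const_smul q⟩) k x := fun q ↦ by
    rw [← mapContinuous_comp_levelHomeo_eq_twist_comp h DN' hH' hΓ' q (πq q) (hπq q), singularCohomology.map_comp]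
    rfl
  change singularCohomology.map ℂ ℂ e k _ = singularCohomology.map ℂ ℂ e k _
  rw [hL, D.levelProj_map_heckeCorrespondenceAction h k x, map_smul, map_sum]
  congr 1
  exact Finset.sum_congr rfl fun q _ ↦ (hR q).symm

/-- **The same in the currency `ℂ ⊗ Hᵏ(·; ℚ)` of the model universe** (#R89 `heckeOpC`, `BettiUniverse.pull`): for `X` smooth projective,
`(π^*)_ℂ (heckeOpC g t) = [Γ ∩ g⁻¹Γg : N_g]⁻¹ • Σ_q (π_q^*)_ℂ t`. [cite: VoisinHodgeI2002, §7.1.1] [cite: Shimura1973, §8.3] -/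
theorem pull_heckeOpC_eq_sum {n : ℕ} (hX : IsSmoothProjective n X) (π : XN' ⟶ X)
    (hπ : ∀ v ∈ DN'.cone, AlgPoints.map π (DN'.unif v) = D.unif v)
    (πq : ↥D.Γ ⧸ D.heckeLevel g → (XN' ⟶ X))
    (hπq : ∀ q, ∀ v ∈ DN'.cone, v ∈ D.cone →
      AlgPoints.map (πq q) (DN'.unif v) = D.unif (D.act (g * ((Quotient.out q : ↥D.Γ) : GL (Fin (p + 1)) D.E)) v))
    (k : ℕ) (t : ℂ ⊗[ℚ] bettiCohomology X k) :
    letI : (D.heckeLevel g).FiniteIndex := h.finiteIndex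
    letI : Fintype (↥D.Γ ⧸ D.heckeLevel g) := Subgroup.fintypeQuotientOfFiniteIndex
    (BettiUniverse.pull π k).baseChange ℂ (heckeOpC D hX k g t) =
      ((D.heckeIndex g : ℂ)⁻¹) • ∑ q : ↥D.Γ ⧸ D.heckeLevel g, (BettiUniverse.pull (πq q) k).baseChange ℂ t := by
  haveI : (D.heckeLevel g).FiniteIndex := h.finiteIndex
  letI : Fintype (↥D.Γ ⧸ D.heckeLevel g) := Subgroup.fintypeQuotientOfFiniteIndex
  apply ofRatClassBaseChange_injective (ComplexPoints XN') k
  have hmain := map_heckeCorrespondenceAction_eq_sum h DN' hH' hΓ' π hπ πq hπq k (ofRatClassBaseChangeEquiv hX k t)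
  rw [← ofRatClassBaseChangeEquiv_heckeOpC D hX k g t] at hmain
  simp only [ofRatClassBaseChangeEquiv_apply] at hmain
  rw [map_ofRatClassBaseChange] at hmain
  rw [map_smul, map_sum]
  refine hmain.trans ?_
  congr 1
  refine Finset.sum_congr rfl fun q _ ↦ ?_
  rw [map_ofRatClassBaseChange]

end Hecke

end HodgeCM.Model.LevelCoverAlgebraic

end
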